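/-
Copyright: the b2b-balaban cell (near-miss cell 7), T⁴-continuum fan-out, lineage t4-ne7b-p1 (node U5c COUNT member).
Released under the licence of the surrounding project.
-/
import Literature.MathematicalPhysics.QuantumFieldTheory.Balaban1983to89.T4PersistenceDictionary

/-!
# Placement skeleton (part 3): the BATCH FACTORIAL is paid by DISTINCT CLASSES — pointwise, K-free

Summits-side support leaf of the T⁴-continuum cell (rung (B)+1 on a FINITE torus only; NOT infinite volume, NOT the
mass gap, NOT the Clay statement; NOT a proof of the spine estimate NE7b).  Lineage `t4-ne7b-p1`, node U5c, wall (GM)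
of the cell's gap census, located item G-ne7bp1g18-2.  [folklore] arithmetic over `ℕ`/`ℝ` and the dictionary's event
alphabet `T4PersistenceDictionary.PEv = (step, kind, fat)`; nothing is quoted from print and nothing printed is asserted.
Independent of parts 1–2 (`Support/PlacementSkeleton.lean`, `Support/PlacementExponent.lean`).

THE LOCATED ITEM.  The merger-multiplicity binder `hlabM` of `T4PartnerMultiplicity` asks for `c^{#events}·Λ′^{partnerAges}`
POINTWISE in the genealogy.  Along a batch of `n` pieces joining one structure AT THE SAME STEP the admissible placements
grow like `(n+1)!` (growth of a cluster cell by cell: the k-th newcomer may touch any of the cells already there — at one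
scale nothing has shrunk yet), so the pointwise `c^{#events}` is false as a shape unless the factorial is paid by something
the genealogy carries.  IT IS: the events of a genealogy form a SET of labels `(step, kind, fat)`, so the births at one
step have PAIRWISE DISTINCT classes `fat = d′`, their total class is at least `0 + 1 + ⋯ + (n−1)`, and half of the class
decay `e^{−μ d′}` of the birth credits pays `n!` with a constant `(1 + 2/μ)` per birth.  This file proves exactly that,
with every constant displayed; the cap `Dcap K` of the alphabet (which is K-dependent, `T4PersistenceDictionary.dictE`) is
NOT used — the exit is K-free.

CONTENTS.  §1 `card_le_of_forall_lt`, `card_mul_pred_le_two_mul_sum` (n distinct naturals sum to at least `n(n−1)/2`).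
§2 `factorial_card_le_pow_mul_exp`: for `μ > 0` and any finite `S ⊆ ℕ`, `|S|! ≤ (1 + 2/μ)^{|S|} · exp((μ/2)·Σ_{d∈S} d)`;
credit form `factorial_mul_exp_neg_le`: `|S|!·e^{−μ Σ d} ≤ (1 + 2/μ)^{|S|}·e^{−(μ/2) Σ d}`.  §3 on the event alphabet:
`birthsAt E t` (the events `(t, 0, d′)` of `E`), `fat_injOn_birthsAt` (classes are distinct within a step),
`factorial_birthsAt_le` (one step), `prod_factorial_birthsAt_le` (all steps of a finite step set `T`:
`∏_{t∈T} n_t! ≤ (1 + 2/μ)^{Σ_t n_t} · exp((μ/2)·Σ_t Σ_{births at t} d′)`), `sum_card_birthsAt` (`Σ_t n_t = #births`).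
§4 decided / computed sanity.

WHAT THIS FILE DOES NOT DO.  It does not re-type `hlabM` (a pointwise binder carrying `∏_t n_t!` beside `c^{#events}` is
the binder owner's re-typing, recorded in the gap census, never a re-wording of the landed declaration); it does not
touch the near-side pair sum of parts 1–2 (an artefact of the pair form, cured by the zone-target assembly — census); it
does not decide how much of `μ` the dictionary's `birthMass` can spare (the (ID)/(E2) owners' constants).

HONEST DEPENDENCY (cell): continuum YM on T⁴ ⇐ BetaPertH ∧ nine spine estimates (0/9 proved); BetaPertH ⇐ (D1) ∧ (D4)
∧ CAP+tail.  This file changes none of it.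
-/

open Finset
open scoped Nat
open Literature.MathematicalPhysics.QuantumFieldTheory.Balaban1983to89
open T4PersistenceDictionary

namespace Summit.QuantumFields.BalabanUV.T4Continuum.PlacementBatch

noncomputable section

/-! ## §1 Distinct naturals -/

/-- A finite set of naturals all below `a` has at most `a` elements. [folklore] -/
theorem card_le_of_forall_lt {s : Finset ℕ} {a : ℕ} (h : ∀ x ∈ s, x < a) : s.card ≤ a :=
  calc s.card ≤ (range a).card := card_le_card fun x hx => mem_range.2 (h x hx)
    _ = a := card_range a

/-- `n` DISTINCT naturals sum to at least `0 + 1 + ⋯ + (n−1)`: `n·(n−1) ≤ 2·Σ_{d ∈ S} d`. [folklore] -/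
theorem card_mul_pred_le_two_mul_sum (S : Finset ℕ) : S.card * (S.card - 1) ≤ 2 * ∑ d ∈ S, d := by
  induction S using Finset.induction_on_max with
  | empty => simp
  | insert a s ha ih =>
      have han : a ∉ s := fun h => lt_irrefl a (ha a h)
      have hc : s.card ≤ a := card_le_of_forall_lt ha
      rw [card_insert_of_notMem han, sum_insert han]
      have key : ∀ c : ℕ, (c + 1) * (c + 1 - 1) = c * (c - 1) + 2 * c := by
        intro c
        cases c with
        | zero => simp
        | succ c => simp only [Nat.succ_sub_one]; ring
      rw [key]
      generalize s.card * (s.card - 1) = P at ih ⊢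
      omega

/-! ## §2 The factorial against half the class decay -/

/-- **THE BATCH FACTORIAL IS PAID BY DISTINCT CLASSES (pointwise form).**  For `μ > 0` and a finite set `S` of
naturals, `|S|! ≤ (1 + 2/μ)^{|S|} · exp((μ/2) · Σ_{d ∈ S} d)`.  Proof: peel off the maximum `a`; the other elements are
`< a`, so there are at most `a` of them, and `|S| ≤ 1 + a ≤ (1 + 2/μ)(1 + μ a/2) ≤ (1 + 2/μ)·e^{μ a/2}`. [folklore] -/
theorem factorial_card_le_pow_mul_exp {μ : ℝ} (hμ : 0 < μ) (S : Finset ℕ) :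
    ((S.card)! : ℝ) ≤ (1 + 2 / μ) ^ S.card * Real.exp (μ / 2 * ∑ d ∈ S, (d : ℝ)) := by
  induction S using Finset.induction_on_max with
  | empty => simp
  | insert a s ha ih =>
      have han : a ∉ s := fun h => lt_irrefl a (ha a h)
      have hc : s.card ≤ a := card_le_of_forall_lt ha
      rw [card_insert_of_notMem han, sum_insert han, Nat.factorial_succ, Nat.cast_mul, pow_succ,
        show μ / 2 * ((a : ℝ) + ∑ x ∈ s, (x : ℝ)) = μ / 2 * (a : ℝ) + μ / 2 * ∑ x ∈ s, (x : ℝ) by ring,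
        Real.exp_add]
      have hC : 0 < 1 + 2 / μ := by positivity
      have h1 : ((s.card + 1 : ℕ) : ℝ) ≤ (1 + 2 / μ) * Real.exp (μ / 2 * (a : ℝ)) := by
        have ha' : (s.card : ℝ) ≤ a := by exact_mod_cast hc
        have hexp : 1 + μ / 2 * (a : ℝ) ≤ Real.exp (μ / 2 * (a : ℝ)) := by
          have := Real.add_one_le_exp (μ / 2 * (a : ℝ)); linarith
        have hμa : 0 ≤ 2 / μ + μ / 2 * (a : ℝ) := by positivity
        have hexpand : (1 + 2 / μ) * (1 + μ / 2 * (a : ℝ)) = 1 + (a : ℝ) + (2 / μ + μ / 2 * (a : ℝ)) := by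
          field_simp
          ring
        calc ((s.card + 1 : ℕ) : ℝ) = (s.card : ℝ) + 1 := by push_cast; ring
          _ ≤ 1 + (a : ℝ) := by linarith
          _ ≤ (1 + 2 / μ) * (1 + μ / 2 * (a : ℝ)) := by rw [hexpand]; linarith
          _ ≤ (1 + 2 / μ) * Real.exp (μ / 2 * (a : ℝ)) := mul_le_mul_of_nonneg_left hexp hC.le
      calc ((s.card + 1 : ℕ) : ℝ) * ((s.card)! : ℝ)
          ≤ ((1 + 2 / μ) * Real.exp (μ / 2 * (a : ℝ))) *
              ((1 + 2 / μ) ^ s.card * Real.exp (μ / 2 * ∑ d ∈ s, (d : ℝ))) :=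
            mul_le_mul h1 ih (by positivity) (by positivity)
        _ = (1 + 2 / μ) ^ s.card * (1 + 2 / μ) *
              (Real.exp (μ / 2 * (a : ℝ)) * Real.exp (μ / 2 * ∑ d ∈ s, (d : ℝ))) := by ring

/-- Credit form: spending HALF of a class decay `e^{−μ d}` per element pays the factorial:
`|S|!·e^{−μ Σ d} ≤ (1 + 2/μ)^{|S|}·e^{−(μ/2) Σ d}`. [folklore] -/
theorem factorial_mul_exp_neg_le {μ : ℝ} (hμ : 0 < μ) (S : Finset ℕ) :
    ((S.card)! : ℝ) * Real.exp (-(μ * ∑ d ∈ S, (d : ℝ))) ≤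
      (1 + 2 / μ) ^ S.card * Real.exp (-(μ / 2 * ∑ d ∈ S, (d : ℝ))) := by
  have h := factorial_card_le_pow_mul_exp hμ S
  have hpos : 0 < Real.exp (-(μ * ∑ d ∈ S, (d : ℝ))) := Real.exp_pos _
  calc ((S.card)! : ℝ) * Real.exp (-(μ * ∑ d ∈ S, (d : ℝ)))
      ≤ ((1 + 2 / μ) ^ S.card * Real.exp (μ / 2 * ∑ d ∈ S, (d : ℝ))) * Real.exp (-(μ * ∑ d ∈ S, (d : ℝ))) :=
        mul_le_mul_of_nonneg_right h hpos.le
    _ = (1 + 2 / μ) ^ S.card * Real.exp (-(μ / 2 * ∑ d ∈ S, (d : ℝ))) := by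
        rw [mul_assoc, ← Real.exp_add]; congr 2; ring

/-! ## §3 On the event alphabet: births at one step have distinct classes -/

/-- The BIRTHS of an event set at step `t`: its events of the form `(t, 0, d′)`. [folklore] -/
def birthsAt (E : Finset PEv) (t : ℕ) : Finset PEv := E.filter fun e => e.step = t ∧ e.kind = 0

/-- membership in `birthsAt` [folklore] -/
@[simp] theorem mem_birthsAt {E : Finset PEv} {t : ℕ} {e : PEv} :
    e ∈ birthsAt E t ↔ e ∈ E ∧ e.step = t ∧ e.kind = 0 := by
  simp [birthsAt]

/-- `birthsAt E t ⊆ E` [folklore] -/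
theorem birthsAt_subset (E : Finset PEv) (t : ℕ) : birthsAt E t ⊆ E := filter_subset _ _

/-- WITHIN ONE STEP THE CLASSES ARE DISTINCT: `fat` is injective on `birthsAt E t` (an event IS the triple
`(step, kind, fat)`). [folklore] -/
theorem fat_injOn_birthsAt (E : Finset PEv) (t : ℕ) : Set.InjOn PEv.fat ↑(birthsAt E t) := by
  rintro ⟨s, k, d⟩ he ⟨s', k', d'⟩ he' h
  simp only [coe_filter, birthsAt, Set.mem_setOf_eq, PEv.step_mk, PEv.kind_mk] at he he'
  simp only [PEv.fat_mk] at h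
  rw [he.2.1, he'.2.1, he.2.2, he'.2.2, h]

/-- the classes of the births at `t` are as many as the births [folklore] -/
theorem card_image_fat_birthsAt (E : Finset PEv) (t : ℕ) :
    ((birthsAt E t).image PEv.fat).card = (birthsAt E t).card :=
  card_image_of_injOn (fat_injOn_birthsAt E t)

/-- the total class of the births at `t`, read on the classes [folklore] -/
theorem sum_image_fat_birthsAt (E : Finset PEv) (t : ℕ) :
    ∑ d ∈ (birthsAt E t).image PEv.fat, (d : ℝ) = ∑ e ∈ birthsAt E t, (e.fat : ℝ) :=
  sum_image fun _ hx _ hy h => fat_injOn_birthsAt E t hx hy h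

/-- **ONE STEP.**  `n_t! ≤ (1 + 2/μ)^{n_t} · exp((μ/2) · Σ_{births at t} d′)`, `n_t = #birthsAt E t`. [folklore] -/
theorem factorial_birthsAt_le {μ : ℝ} (hμ : 0 < μ) (E : Finset PEv) (t : ℕ) :
    (((birthsAt E t).card)! : ℝ) ≤
      (1 + 2 / μ) ^ (birthsAt E t).card * Real.exp (μ / 2 * ∑ e ∈ birthsAt E t, (e.fat : ℝ)) := by
  have h := factorial_card_le_pow_mul_exp hμ ((birthsAt E t).image PEv.fat)
  rwa [card_image_fat_birthsAt, sum_image_fat_birthsAt] at h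

/-- **ALL STEPS.**  For a finite set of steps `T`:
`∏_{t ∈ T} n_t! ≤ (1 + 2/μ)^{Σ_{t∈T} n_t} · exp((μ/2) · Σ_{t∈T} Σ_{births at t} d′)`. [folklore] -/
theorem prod_factorial_birthsAt_le {μ : ℝ} (hμ : 0 < μ) (E : Finset PEv) (T : Finset ℕ) :
    ∏ t ∈ T, (((birthsAt E t).card)! : ℝ) ≤
      (1 + 2 / μ) ^ (∑ t ∈ T, (birthsAt E t).card) *
        Real.exp (μ / 2 * ∑ t ∈ T, ∑ e ∈ birthsAt E t, (e.fat : ℝ)) := by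
  rw [← prod_pow_eq_pow_sum, mul_sum, Real.exp_sum, ← prod_mul_distrib]
  exact prod_le_prod (fun t _ => by positivity) fun t _ => factorial_birthsAt_le hμ E t

/-- The step counts add up to the number of births whose step lies in `T`. [folklore] -/
theorem sum_card_birthsAt (E : Finset PEv) (T : Finset ℕ) (hT : ∀ e ∈ E, e.kind = 0 → e.step ∈ T) :
    ∑ t ∈ T, (birthsAt E t).card = (E.filter fun e => e.kind = 0).card := by
  rw [card_eq_sum_card_fiberwise (f := PEv.step) (t := T)
    (fun e he => hT e (mem_filter.1 he).1 (mem_filter.1 he).2)]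
  refine sum_congr rfl fun t _ => ?_
  rw [birthsAt, filter_filter]
  exact congrArg Finset.card (filter_congr fun e _ => by tauto)

/-- **POINTWISE BOOKING (the K-free exit of the located item).**  For an event set `E` all of whose births have their
step in `T` and class credits `e^{−μ d′}`:
`(∏_{t∈T} n_t!) · ∏_{births} e^{−μ d′} ≤ (1 + 2/μ)^{#births} · ∏_{births} e^{−(μ/2) d′}` —
the per-step batch factorials cost a constant `1 + 2/μ` per birth and half the class decay, nothing else. [folklore] -/
theorem prod_factorial_mul_credits_le {μ : ℝ} (hμ : 0 < μ) (E : Finset PEv) (T : Finset ℕ)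
    (hT : ∀ e ∈ E, e.kind = 0 → e.step ∈ T) :
    (∏ t ∈ T, (((birthsAt E t).card)! : ℝ)) *
        ∏ e ∈ E.filter (fun e => e.kind = 0), Real.exp (-(μ * (e.fat : ℝ))) ≤
      (1 + 2 / μ) ^ (E.filter fun e => e.kind = 0).card *
        ∏ e ∈ E.filter (fun e => e.kind = 0), Real.exp (-(μ / 2 * (e.fat : ℝ))) := by
  have hfib : ∑ t ∈ T, ∑ e ∈ birthsAt E t, (e.fat : ℝ) = ∑ e ∈ E.filter (fun e => e.kind = 0), (e.fat : ℝ) := by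
    rw [← sum_fiberwise_of_maps_to (s := E.filter fun e => e.kind = 0) (t := T) (g := PEv.step)
      (fun e he => hT e (mem_filter.1 he).1 (mem_filter.1 he).2)]
    refine sum_congr rfl fun t _ => sum_congr ?_ fun _ _ => rfl
    rw [birthsAt, filter_filter]
    exact filter_congr fun e _ => by tauto
  have h := prod_factorial_birthsAt_le hμ E T
  rw [sum_card_birthsAt E T hT, hfib] at h
  have hpos : 0 < ∏ e ∈ E.filter (fun e => e.kind = 0), Real.exp (-(μ * (e.fat : ℝ))) :=
    prod_pos fun e _ => Real.exp_pos _
  calc (∏ t ∈ T, (((birthsAt E t).card)! : ℝ)) * ∏ e ∈ E.filter (fun e => e.kind = 0), Real.exp (-(μ * (e.fat : ℝ)))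
      ≤ ((1 + 2 / μ) ^ (E.filter fun e => e.kind = 0).card *
          Real.exp (μ / 2 * ∑ e ∈ E.filter (fun e => e.kind = 0), (e.fat : ℝ))) *
          ∏ e ∈ E.filter (fun e => e.kind = 0), Real.exp (-(μ * (e.fat : ℝ))) :=
        mul_le_mul_of_nonneg_right h hpos.le
    _ = (1 + 2 / μ) ^ (E.filter fun e => e.kind = 0).card *
          ∏ e ∈ E.filter (fun e => e.kind = 0), Real.exp (-(μ / 2 * (e.fat : ℝ))) := by
        rw [mul_assoc, mul_sum, Real.exp_sum, ← prod_mul_distrib]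
        congr 1
        refine prod_congr rfl fun e _ => ?_
        rw [← Real.exp_add]; congr 1; ring

/-! ## §4 Sanity -/

namespace Sanity

/-- three births at step 5 with classes 0, 1, 2 and one merger: `birthsAt` finds the three births [decided] -/
theorem birthsAt_example :
    (birthsAt ({((5 : ℕ), (0 : Fin 3), (0 : ℕ)), (5, 0, 1), (5, 0, 2), (5, 2, 0)} : Finset PEv) 5).card = 3 := by
  decide

/-- the arithmetic of §1 on the classes `{0, 1, 2}`: `3·2 ≤ 2·(0+1+2)` with equality [decided] -/
theorem distinct_classes_example : 3 * (3 - 1) = 2 * ∑ d ∈ ({0, 1, 2} : Finset ℕ), d := by decide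

/-- the constant at `μ = 2` is `2` per birth: `3! = 6 ≤ 2^3 · e^{(2/2)·(0+1+2)} = 8·e^3` [folklore] -/
theorem factorial_three_le : ((3 : ℕ)! : ℝ) ≤ (1 + 2 / 2) ^ 3 * Real.exp (2 / 2 * (0 + 1 + 2)) := by
  have h1 : (1 : ℝ) ≤ Real.exp (2 / 2 * (0 + 1 + 2)) := Real.one_le_exp (by norm_num)
  have : ((3 : ℕ)! : ℝ) = 6 := by norm_num [Nat.factorial]
  rw [this]; nlinarith

end Sanity

end

end Summit.QuantumFields.BalabanUV.T4Continuum.PlacementBatch
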